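import Mathlib
import Summits.QuantumFields.YangMills.Theorems.ConvexGribovBodyContinuumLegGivenGapStubCsclKLevelB
import Summits.QuantumFields.YangMills.Theorems.ConvexGribovBodyContinuumLegGivenGapStubCsclLimitCS
import Summits.QuantumFields.YangMills.Theorems.ConvexGribovBodyContinuumLegGivenGapStubCsclKernel
import Summits.QuantumFields.YangMills.Theorems.ConvexGribovBodyContinuumLegGivenGapStubCsclNearFar
import HarnessLib

/-!
# `ContinuumLegGivenGap` (stmt-QuantumFields-15828), line `Sketch`, reshape 18b: `stub_csclKLevel` — uniform Cauchy–Schwarz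
# clustering on a late torus (part C: the main assembly and the registered stub)

Support file for the crux item stmt-QuantumFields-15828 (registered glue stub `stub_csclKLevel` of line `Sketch`, reshape 18b).
At one coupling `β ≥ 0` with the locked volume-uniform lattice gap at `(β, μ, S₁)` on a cofinal set `𝓛` of tori, for every
tolerance `τ`, complexity bound `Nmax`, shift range `σmax` and `Lmin` there is a torus `L ∈ 𝓛`, `L ≥ Lmin`, on which the centred
reflection pairings of the lattice representatives (box `L`, centring by the torus mean) of ALL test functions supported at times
in `[a, T]` with `≤ Nmax` points satisfy the Osterwalder–Schrader Cauchy–Schwarz clustering bound at rate `μ` up to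
`τ ‖F‖_{8n} ‖H‖_{8m}`. Assembly (`klevel_main`): diagonal extraction of a sequence of tori in `𝓛` along which all raw monomial
pairings converge (`klevel_extract`, from `csclReal_diagonal`); ONE tail radius `R` for all `p ≤ Nmax` (`csclLattice_tail`); the
near (box-`R`, limit-mean-centred) representatives obey the exact limit inequality (`stub_csclLimitCS`) and are uniformly close to
their limits at a late index (`stub_csclKernel`); the full representatives differ from the near ones by far tails and the mean
defect in sup norm (`stub_csclNearFar`), and the budget `klevel_budget` closes the `τ`-bracket (`klevel_chain`, `klevel_endgame`).
Part A (`…StubCsclKLevelA`) holds the elementary bounds, part B (`…StubCsclKLevelB`) the extraction, chain and budget. No definitions, no facts; Mathlib + landed tree lemmas only. [folklore]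
-/

noncomputable section

namespace Summit.QuantumFields.YangMills.Theorems.ContinuumLegGivenGap

open scoped SchwartzMap ComplexConjugate
open Filter Topology MeasureTheory
open Literature.MathematicalPhysics.QuantumFieldTheory Literature.MathematicalPhysics.QuantumLattice
  Literature.MathematicalPhysics.AQFT Literature.Probability.LatticeModels
open Summit.QuantumFields.YangMills.Cruxes.ContinuumLimitOnTrajectory.TwoOrbitSynchronisation
  (norm_apply_le_schwartzNorm_mul sum_norm_apply_smul_siteToE_le)

section Main
set_option maxHeartbeats 400000 in
/-- **Main lemma** (= the registered `stub_csclKLevel`, with the three glue stubs of reshape 18b as explicit hypotheses). [folklore] -/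
theorem klevel_main
    (hLimit : ∀ (G : Type) [Group G] [TopologicalSpace G] [IsTopologicalGroup G] [CompactSpace G]
        [MeasurableSpace G] [BorelSpace G] (r : LatticeRep G) (β μ mc : ℝ) (S₁ T n m R : ℕ) (Sq : ℕ → ℕ)
        (w : (Fin n → ↥(box 4 R)) → ℂ) (w' : (Fin m → ↥(box 4 R)) → ℂ),
        0 ≤ β → 0 < μ → StrictMono Sq → (∀ j, S₁ ≤ Sq j) →
        (∀ A B : YMSpecies G, ∃ C : ℝ, ∀ S n : ℕ, S₁ ≤ S → n ≤ S →
          |latticeConnectedCorr r.ρ β (2 * S + 1) A.F B.F n| ≤ C * Real.exp (-(μ * n))) →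
        (∀ x, w x ≠ 0 → ∀ i, 1 ≤ (↑(x i) : Site 4) 0 ∧ (↑(x i) : Site 4) 0 ≤ (T : ℤ)) →
        (∀ y, w' y ≠ 0 → ∀ i, 1 ≤ (↑(y i) : Site 4) 0 ∧ (↑(y i) : Site 4) 0 ≤ (T : ℤ)) →
        (∀ (p q : ℕ) (u : Fin p → Site 4) (v : Fin q → Site 4) (σ : ℕ), ∃ l : ℝ,
          Tendsto (fun j : ℕ => ∫ U : GaugeConfig 4 (2 * Sq j + 1) G,
            (∏ i : Fin p, r.curvature.F (configShift (-(u i)) (cfgReflect (torusLift (2 * Sq j + 1) U)))) *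
              (∏ i : Fin q, r.curvature.F (configShift (-(v i)) (configShift (-(Pi.single 0 ((σ : ℕ) : ℤ))) (torusLift (2 * Sq j + 1) U))))
            ∂(wilsonMeasure r.ρ β)) atTop (𝓝 l)) →
        ∃ vX vY : ℝ,
          Tendsto (fun j : ℕ => (((∫ U : GaugeConfig 4 (2 * Sq j + 1) G, (starRingEnd ℂ) ((fun V => ∑ x : Fin n → ↥(box 4 R), w x * ∏ i, ((r.curvature.F (configShift (-↑(x i)) V) - mc : ℝ) : ℂ)) (cfgReflect (torusLift (2 * Sq j + 1) U))) * (fun V => ∑ x : Fin n → ↥(box 4 R), w x * ∏ i, ((r.curvature.F (configShift (-↑(x i)) V) - mc : ℝ) : ℂ)) (configShift (-(Pi.single 0 ((0 : ℕ) : ℤ))) (torusLift (2 * Sq j + 1) U)) ∂(wilsonMeasure r.ρ β)) - (starRingEnd ℂ) (∫ U : GaugeConfig 4 (2 * Sq j + 1) G, (fun V => ∑ x : Fin n → ↥(box 4 R), w x * ∏ i, ((r.curvature.F (configShift (-↑(x i)) V) - mc : ℝ) : ℂ)) (torusLift (2 * Sq j + 1) U) ∂(wilsonMeasure r.ρ β))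 * (∫ U : GaugeConfig 4 (2 * Sq j + 1) G, (fun V => ∑ x : Fin n → ↥(box 4 R), w x * ∏ i, ((r.curvature.F (configShift (-↑(x i)) V) - mc : ℝ) : ℂ)) (torusLift (2 * Sq j + 1) U) ∂(wilsonMeasure r.ρ β)))).re) atTop (𝓝 vX) ∧
          Tendsto (fun j : ℕ => (((∫ U : GaugeConfig 4 (2 * Sq j + 1) G, (starRingEnd ℂ) ((fun V => ∑ x : Fin m → ↥(box 4 R), w' x * ∏ i, ((r.curvature.F (configShift (-↑(x i)) V) - mc : ℝ) : ℂ)) (cfgReflect (torusLift (2 * Sq j + 1) U))) * (fun V => ∑ x : Fin m → ↥(box 4 R), w' x * ∏ i, ((r.curvature.F (configShift (-↑(x i)) V) - mc : ℝ) : ℂ)) (configShift (-(Pi.single 0 ((0 : ℕ) : ℤ))) (torusLift (2 * Sq j + 1) U)) ∂(wilsonMeasure r.ρ β)) - (starRingEnd ℂ) (∫ U : GaugeConfig 4 (2 * Sq j + 1) G, (fun V => ∑ x : Fin m → ↥(box 4 R), w' x * ∏ i, ((r.curvature.F (configShift (-↑(x i)) V) - mc : ℝ) : ℂ)) (torusLift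 (2 * Sq j + 1) U) ∂(wilsonMeasure r.ρ β)) * (∫ U : GaugeConfig 4 (2 * Sq j + 1) G, (fun V => ∑ x : Fin m → ↥(box 4 R), w' x * ∏ i, ((r.curvature.F (configShift (-↑(x i)) V) - mc : ℝ) : ℂ)) (torusLift (2 * Sq j + 1) U) ∂(wilsonMeasure r.ρ β)))).re) atTop (𝓝 vY) ∧
          ∀ σ : ℕ, ∃ l : ℂ, Tendsto (fun j : ℕ => ((∫ U : GaugeConfig 4 (2 * Sq j + 1) G, (starRingEnd ℂ) ((fun V => ∑ x : Fin n → ↥(box 4 R), w x * ∏ i, ((r.curvature.F (configShift (-↑(x i)) V) - mc : ℝ) : ℂ)) (cfgReflect (torusLift (2 * Sq j + 1) U))) * (fun V => ∑ x : Fin m → ↥(box 4 R), w' x * ∏ i, ((r.curvature.F (configShift (-↑(x i)) V) - mc : ℝ) : ℂ)) (configShift (-(Pi.single 0 ((σ : ℕ) : ℤ))) (torusLift (2 * Sq j + 1) U)) ∂(wilsonMeasure r.ρ β)) - (starRingEnd ℂ) (∫ U : GaugeConfig 4 (2 * Sq j + 1) G, (fun V => ∑ x : Fin n → ↥(box 4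 R), w x * ∏ i, ((r.curvature.F (configShift (-↑(x i)) V) - mc : ℝ) : ℂ)) (torusLift (2 * Sq j + 1) U) ∂(wilsonMeasure r.ρ β)) * (∫ U : GaugeConfig 4 (2 * Sq j + 1) G, (fun V => ∑ x : Fin m → ↥(box 4 R), w' x * ∏ i, ((r.curvature.F (configShift (-↑(x i)) V) - mc : ℝ) : ℂ)) (torusLift (2 * Sq j + 1) U) ∂(wilsonMeasure r.ρ β)))) atTop (𝓝 l) ∧
            ‖l‖ ≤ Real.exp (-(μ * σ)) * Real.sqrt vX * Real.sqrt vY)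
    (hKer : ∀ (G : Type) [Group G] [TopologicalSpace G] [IsTopologicalGroup G] [CompactSpace G]
        [MeasurableSpace G] [BorelSpace G] (r : LatticeRep G) (β mc : ℝ) (n m R : ℕ) (Sq : ℕ → ℕ),
        (∀ (p q : ℕ) (u : Fin p → Site 4) (v : Fin q → Site 4) (σ : ℕ), ∃ l : ℝ,
          Tendsto (fun j : ℕ => ∫ U : GaugeConfig 4 (2 * Sq j + 1) G,
            (∏ i : Fin p, r.curvature.F (configShift (-(u i)) (cfgReflect (torusLift (2 * Sq j + 1) U)))) *
              (∏ i : Fin q, r.curvature.F (configShift (-(v i)) (configShift (-(Pi.single 0 ((σ : ℕ) : ℤ))) (torusLift (2 * Sq j + 1) U))))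
            ∂(wilsonMeasure r.ρ β)) atTop (𝓝 l)) →
        ∀ (δ : ℝ) (σmax : ℕ), 0 < δ → ∃ j₀ : ℕ, ∀ j : ℕ, j₀ ≤ j →
          ∀ (w : (Fin n → ↥(box 4 R)) → ℂ) (w' : (Fin m → ↥(box 4 R)) → ℂ) (σ : ℕ) (l : ℂ), σ ≤ σmax →
            Tendsto (fun j : ℕ => ((∫ U : GaugeConfig 4 (2 * Sq j + 1) G, (starRingEnd ℂ) ((fun V => ∑ x : Fin n → ↥(box 4 R), w x * ∏ i, ((r.curvature.F (configShift (-↑(x i)) V) - mc : ℝ) : ℂ)) (cfgReflect (torusLift (2 * Sq j + 1) U))) * (fun V => ∑ x : Fin m → ↥(box 4 R), w' x * ∏ i, ((r.curvature.F (configShift (-↑(x i)) V) - mc : ℝ) : ℂ)) (configShift (-(Pi.single 0 ((σ : ℕ) : ℤ))) (torusLift (2 * Sq j + 1) U)) ∂(wilsonMeasure r.ρ β)) - (starRingEnd ℂ) (∫ U : GaugeConfig 4 (2 * Sq j + 1) G, (fun V => ∑ x : Fin n → ↥(box 4 R), w x * ∏ i, ((r.curvature.F (configShift (-↑(x i)) V)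 - mc : ℝ) : ℂ)) (torusLift (2 * Sq j + 1) U) ∂(wilsonMeasure r.ρ β)) * (∫ U : GaugeConfig 4 (2 * Sq j + 1) G, (fun V => ∑ x : Fin m → ↥(box 4 R), w' x * ∏ i, ((r.curvature.F (configShift (-↑(x i)) V) - mc : ℝ) : ℂ)) (torusLift (2 * Sq j + 1) U) ∂(wilsonMeasure r.ρ β)))) atTop (𝓝 l) →
            ‖((∫ U : GaugeConfig 4 (2 * Sq j + 1) G, (starRingEnd ℂ) ((fun V => ∑ x : Fin n → ↥(box 4 R), w x * ∏ i, ((r.curvature.F (configShift (-↑(x i)) V) - mc : ℝ) : ℂ)) (cfgReflect (torusLift (2 * Sq j + 1) U))) * (fun V => ∑ x : Fin m → ↥(box 4 R), w' x * ∏ i, ((r.curvature.F (configShift (-↑(x i)) V) - mc : ℝ) : ℂ)) (configShift (-(Pi.single 0 ((σ : ℕ) : ℤ))) (torusLift (2 * Sq j + 1) U)) ∂(wilsonMeasure r.ρ β)) - (starRingEnd ℂ) (∫ U : GaugeConfig 4 (2 * Sq j + 1) G, (fun V => ∑ x : Fin n → ↥(box 4 R), w x * ∏ i, ((r.curvature.F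 (configShift (-↑(x i)) V) - mc : ℝ) : ℂ)) (torusLift (2 * Sq j + 1) U) ∂(wilsonMeasure r.ρ β)) * (∫ U : GaugeConfig 4 (2 * Sq j + 1) G, (fun V => ∑ x : Fin m → ↥(box 4 R), w' x * ∏ i, ((r.curvature.F (configShift (-↑(x i)) V) - mc : ℝ) : ℂ)) (torusLift (2 * Sq j + 1) U) ∂(wilsonMeasure r.ρ β))) - l‖ ≤
              δ * (∑ x : Fin n → ↥(box 4 R), ‖w x‖) * (∑ y : Fin m → ↥(box 4 R), ‖w' y‖))
    (hNF : ∀ (G : Type) [Group G] [TopologicalSpace G] [IsTopologicalGroup G] [CompactSpace G]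
        [MeasurableSpace G] [BorelSpace G] (r : LatticeRep G) (β : ℝ),
        (∀ (S : ℕ) (X X' Y Y' : LGConfig 4 G → ℂ) (BX BY ηX ηY : ℝ), Measurable X → Measurable X' → Measurable Y →
          Measurable Y' → (∀ V, ‖X V‖ ≤ BX) → (∀ V, ‖X' V‖ ≤ BX) → (∀ V, ‖Y V‖ ≤ BY) → (∀ V, ‖Y' V‖ ≤ BY) →
          (∀ V, ‖X V - X' V‖ ≤ ηX) → (∀ V, ‖Y V - Y' V‖ ≤ ηY) → ∀ σ : ℕ,
          ‖((∫ U : GaugeConfig 4 (2 * S + 1) G, (starRingEnd ℂ) (X (cfgReflect (torusLift (2 * S + 1) U))) * Y (configShift (-(Pi.single 0 ((σ : ℕ) : ℤ))) (torusLift (2 * S + 1) U)) ∂(wilsonMeasure r.ρ β)) - (starRingEnd ℂ) (∫ U : GaugeConfig 4 (2 * S + 1) G, X (torusLift (2 * S + 1) U) ∂(wilsonMeasure r.ρ β)) * (∫ U : GaugeConfig 4 (2 * S + 1) G, Y (torusLift (2 * S + 1) U) ∂(wilsonMeasure r.ρ β))) -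
              ((∫ U : GaugeConfig 4 (2 * S + 1) G, (starRingEnd ℂ) (X' (cfgReflect (torusLift (2 * S + 1) U))) * Y' (configShift (-(Pi.single 0 ((σ : ℕ) : ℤ))) (torusLift (2 * S + 1) U)) ∂(wilsonMeasure r.ρ β)) - (starRingEnd ℂ) (∫ U : GaugeConfig 4 (2 * S + 1) G, X' (torusLift (2 * S + 1) U) ∂(wilsonMeasure r.ρ β)) * (∫ U : GaugeConfig 4 (2 * S + 1) G, Y' (torusLift (2 * S + 1) U) ∂(wilsonMeasure r.ρ β)))‖ ≤ 2 * (ηX * BY + BX * ηY)) ∧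
        (∀ (n R L : ℕ) (a mc mc' MP : ℝ) (F : SchwartzMap (Fin n → EuclideanSpace ℝ (Fin 4)) ℂ), R ≤ L →
          (∀ U, |r.curvature.F U| ≤ MP) → |mc| ≤ MP → |mc'| ≤ MP → ∀ V : LGConfig 4 G,
          ‖(fun V => ∑ x : Fin n → ↥(box 4 L), F (fun i => a • siteToE ↑(x i)) * ∏ i, ((r.curvature.F (configShift (-↑(x i)) V) - mc : ℝ) : ℂ)) V -
              (fun V => ∑ x : Fin n → ↥(box 4 R), (fun x => F (fun i => a • siteToE ↑(x i))) x * ∏ i, ((r.curvature.F (configShift (-↑(x i)) V) - mc' : ℝ) : ℂ)) V‖ ≤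
            (2 * MP + 1) ^ n * (∑ x : Fin n → ↥(box 4 L),
                if (∀ i, (↑(x i) : Site 4) ∈ box 4 R) then 0 else ‖F (fun i => a • siteToE ↑(x i))‖) +
              n * (2 * MP + 1) ^ n * |mc - mc'| * ∑ x : Fin n → ↥(box 4 L), ‖F (fun i => a • siteToE ↑(x i))‖)) :
    ∀ (G : Type) [Group G] [TopologicalSpace G] [IsTopologicalGroup G] [CompactSpace G]
        [MeasurableSpace G] [BorelSpace G] (r : LatticeRep G) (β μ a : ℝ) (S₁ : ℕ) (𝓛 : Set ℕ),
        0 ≤ β → 0 < μ → 0 < a → (∀ S : ℕ, ∃ S' : ℕ, S' ∈ 𝓛 ∧ S ≤ S') → (∀ S ∈ 𝓛, S₁ ≤ S) →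
        (∀ A B : YMSpecies G, ∃ C : ℝ, ∀ S n : ℕ, S₁ ≤ S → n ≤ S →
          |latticeConnectedCorr r.ρ β (2 * S + 1) A.F B.F n| ≤ C * Real.exp (-(μ * n))) →
        ∀ (τ : ℝ) (Nmax σmax Lmin : ℕ), 0 < τ → ∃ L : ℕ, L ∈ 𝓛 ∧ Lmin ≤ L ∧
          ∀ (n m : ℕ) (F : SchwartzMap (Fin n → EuclideanSpace ℝ (Fin 4)) ℂ)
            (H : SchwartzMap (Fin m → EuclideanSpace ℝ (Fin 4)) ℂ) (T : ℝ), n ≤ Nmax → m ≤ Nmax →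
            tsupport (F : (Fin n → EuclideanSpace ℝ (Fin 4)) → ℂ) ⊆ {x | ∀ i, a ≤ x i 0 ∧ x i 0 ≤ T} →
            tsupport (H : (Fin m → EuclideanSpace ℝ (Fin 4)) → ℂ) ⊆ {x | ∀ i, a ≤ x i 0 ∧ x i 0 ≤ T} →
            ∀ σ : ℕ, σ ≤ σmax →
              ‖((∫ U : GaugeConfig 4 (2 * L + 1) G, (starRingEnd ℂ) ((fun V => ∑ x : Fin n → ↥(box 4 L), F (fun i => a • siteToE ↑(x i)) * ∏ i, ((r.curvature.F (configShift (-↑(x i)) V) - (wilsonTorusMean r.ρ β L r.curvature.F) : ℝ) : ℂ)) (cfgReflect (torusLift (2 * L + 1) U))) * (fun V => ∑ x : Fin m → ↥(box 4 L), H (fun i => a • siteToE ↑(x i)) * ∏ i, ((r.curvature.F (configShift (-↑(x i)) V) - (wilsonTorusMean r.ρ β L r.curvature.F) : ℝ) : ℂ)) (configShift (-(Pi.single 0 ((σ : ℕ) : ℤ))) (torusLift (2 * L + 1) U)) ∂(wilsonMeasure r.ρ β)) - (starRingEnd ℂ) (∫ U : GaugeConfig 4 (2 * L + 1) G, (fun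 V => ∑ x : Fin n → ↥(box 4 L), F (fun i => a • siteToE ↑(x i)) * ∏ i, ((r.curvature.F (configShift (-↑(x i)) V) - (wilsonTorusMean r.ρ β L r.curvature.F) : ℝ) : ℂ)) (torusLift (2 * L + 1) U) ∂(wilsonMeasure r.ρ β)) * (∫ U : GaugeConfig 4 (2 * L + 1) G, (fun V => ∑ x : Fin m → ↥(box 4 L), H (fun i => a • siteToE ↑(x i)) * ∏ i, ((r.curvature.F (configShift (-↑(x i)) V) - (wilsonTorusMean r.ρ β L r.curvature.F) : ℝ) : ℂ)) (torusLift (2 * L + 1) U) ∂(wilsonMeasure r.ρ β)))‖ ≤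
                Real.exp (-(μ * σ)) * Real.sqrt ‖∫ U : GaugeConfig 4 (2 * L + 1) G, (starRingEnd ℂ) ((fun V => ∑ x : Fin n → ↥(box 4 L), F (fun i => a • siteToE ↑(x i)) * ∏ i, ((r.curvature.F (configShift (-↑(x i)) V) - (wilsonTorusMean r.ρ β L r.curvature.F) : ℝ) : ℂ)) (cfgReflect (torusLift (2 * L + 1) U))) * (fun V => ∑ x : Fin n → ↥(box 4 L), F (fun i => a • siteToE ↑(x i)) * ∏ i, ((r.curvature.F (configShift (-↑(x i)) V) - (wilsonTorusMean r.ρ β L r.curvature.F) : ℝ) : ℂ)) (configShift (-(Pi.single 0 ((0 : ℕ) : ℤ))) (torusLift (2 * L + 1) U)) ∂(wilsonMeasure r.ρ β)‖ *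
                  Real.sqrt ‖∫ U : GaugeConfig 4 (2 * L + 1) G, (starRingEnd ℂ) ((fun V => ∑ x : Fin m → ↥(box 4 L), H (fun i => a • siteToE ↑(x i)) * ∏ i, ((r.curvature.F (configShift (-↑(x i)) V) - (wilsonTorusMean r.ρ β L r.curvature.F) : ℝ) : ℂ)) (cfgReflect (torusLift (2 * L + 1) U))) * (fun V => ∑ x : Fin m → ↥(box 4 L), H (fun i => a • siteToE ↑(x i)) * ∏ i, ((r.curvature.F (configShift (-↑(x i)) V) - (wilsonTorusMean r.ρ β L r.curvature.F) : ℝ) : ℂ)) (configShift (-(Pi.single 0 ((0 : ℕ) : ℤ))) (torusLift (2 * L + 1) U)) ∂(wilsonMeasure r.ρ β)‖ +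
                τ * schwartzNorm (8 * n) F * schwartzNorm (8 * m) H := by
  intro G _ _ _ _ _ _ r β μ a S₁ 𝓛 hβ hμ ha hcof hS₁ hlock τ Nmax σmax Lmin hτ
  -- ## constants
  obtain ⟨MP₀, hMP₀⟩ := r.curvature.bounded
  set MP : ℝ := max MP₀ 0 with hMPdef
  have hMP : ∀ U, |r.curvature.F U| ≤ MP := fun U => (hMP₀ U).trans (le_max_left _ _)
  have hMP0 : 0 ≤ MP := le_max_right _ _
  clear_value MP
  -- Schwartz lattice-sum constant, uniform over `n ≤ Nmax` and all boxes
  obtain ⟨Cn, hCn⟩ : ∃ Cn : ℕ → ℝ, Cn = fun n => (a ^ (4 * n))⁻¹ * (2 * (a + 1)) ^ (4 * n) * 2 ^ (8 * n) :=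
    ⟨_, rfl⟩
  have hCn0 : ∀ n, 0 ≤ Cn n := fun n => by simp only [hCn]; positivity
  have hCsum : ∀ (n S : ℕ) (F : SchwartzMap (Fin n → EuclideanSpace ℝ (Fin 4)) ℂ),
      ∑ x : Fin n → ↥(box 4 S), ‖F (fun i => a • siteToE (↑(x i) : Site 4))‖ ≤ Cn n * schwartzNorm (8 * n) F := by
    intro n S F
    have h := sum_norm_apply_smul_siteToE_le ha S F
    simp only [hCn]
    linarith [h]
  set Cstar : ℝ := ∑ n ∈ Finset.range (Nmax + 1), Cn n with hCstar
  have hCle : ∀ n, n ≤ Nmax → Cn n ≤ Cstar := fun n hn =>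
    Finset.single_le_sum (f := Cn) (fun i _ => hCn0 i) (Finset.mem_range.2 (Nat.lt_succ_of_le hn))
  have hCstar0 : 0 ≤ Cstar := Finset.sum_nonneg fun i _ => hCn0 i
  clear_value Cstar
  -- monomial sup bound `(2MP+1)^n ≤ Bmono`
  set Bmono : ℝ := (2 * MP + 1) ^ Nmax with hBmono
  have hB1 : 1 ≤ 2 * MP + 1 := by linarith
  have hBle : ∀ n, n ≤ Nmax → (2 * MP + 1) ^ n ≤ Bmono := fun n hn => pow_le_pow_right₀ hB1 hn
  have hBmono1 : 1 ≤ Bmono := one_le_pow₀ hB1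
  have hBmono0 : 0 < Bmono := by linarith
  clear_value Bmono
  set Bstar : ℝ := Cstar * Bmono with hBstar
  have hBstar0 : 0 ≤ Bstar := mul_nonneg hCstar0 hBmono0.le
  -- ## smallness parameters
  set θ : ℝ := min 1 (τ / (15 + 6 * Bstar)) with hθ
  have hθ0 : 0 < θ := lt_min one_pos (div_pos hτ (by linarith))
  have hθ1 : θ ≤ 1 := min_le_left _ _
  have hθτ : θ * (15 + 6 * Bstar) ≤ τ := by
    have : θ ≤ τ / (15 + 6 * Bstar) := min_le_right _ _
    rwa [le_div_iff₀ (by linarith)] at this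
  clear_value θ
  set δB : ℝ := (θ / (Cstar + 1)) ^ 2 with hδB
  have hδB0 : 0 < δB := pow_pos (div_pos hθ0 (by linarith)) 2
  set ηtar : ℝ := θ ^ 2 / (Bstar + 1) with hηtar
  have hηtar0 : 0 < ηtar := div_pos (pow_pos hθ0 2) (by linarith)
  set εR : ℝ := ηtar / (2 * Bmono * 2 ^ (8 * Nmax) + 1) with hεR
  have hεR0 : 0 < εR := div_pos hηtar0 (by positivity)
  set δm : ℝ := ηtar / (2 * Bmono * Nmax * Cstar + 1) with hδm
  have hδm0 : 0 < δm := div_pos hηtar0 (by positivity)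
  clear_value δB ηtar εR δm
  -- ## tails: one radius `R` for all `p ≤ Nmax`
  choose Rf hRf using fun p : ℕ => csclLattice_tail a p ha εR hεR0
  set R : ℕ := ∑ p ∈ Finset.range (Nmax + 1), Rf p with hR
  have hRle : ∀ p, p ≤ Nmax → Rf p ≤ R := fun p hp =>
    Finset.single_le_sum (f := Rf) (fun i _ => Nat.zero_le _) (Finset.mem_range.2 (Nat.lt_succ_of_le hp))
  have htail : ∀ p, p ≤ Nmax → ∀ T : Finset (Fin p → Site 4), (∀ y ∈ T, ∃ i, y i ∉ box 4 R) →
      ∑ y ∈ T, ((1 + ‖fun i => a • siteToE (y i)‖) ^ (8 * p))⁻¹ ≤ εR := by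
    intro p hp T hT
    refine hRf p T fun y hy => ?_
    obtain ⟨i, hi⟩ := hT y hy
    exact ⟨i, fun h => hi (box_mono 4 (hRle p hp) h)⟩
  -- ## extraction inside `𝓛'' = {S ∈ 𝓛 | max Lmin R ≤ S}`
  obtain ⟨Sq, hSq, hSq𝓛, hraw, mi, hmi⟩ := klevel_extract r β {S | S ∈ 𝓛 ∧ max Lmin R ≤ S} (fun S => by
    obtain ⟨S', hS', hSS'⟩ := hcof (max S (max Lmin R))
    exact ⟨S', ⟨hS', (le_max_right _ _).trans hSS'⟩, (le_max_left _ _).trans hSS'⟩)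
  have hSqS₁ : ∀ j, S₁ ≤ Sq j := fun j => hS₁ _ (hSq𝓛 j).1
  have hmiMP : |mi| ≤ MP :=
    le_of_tendsto' ((continuous_abs.tendsto _).comp hmi) fun j => klevel_abs_mean_le r β _ hMP
  -- ## kernel uniformity thresholds (all `n, m ≤ Nmax`) and the mean threshold
  choose j0f hj0f using fun n m : ℕ => hKer G r β mi n m R Sq hraw δB σmax hδB0
  set J₀ : ℕ := ∑ n ∈ Finset.range (Nmax + 1), ∑ m ∈ Finset.range (Nmax + 1), j0f n m with hJ₀
  have hJ₀le : ∀ n m, n ≤ Nmax → m ≤ Nmax → j0f n m ≤ J₀ := by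
    intro n m hn hm
    calc j0f n m ≤ ∑ m' ∈ Finset.range (Nmax + 1), j0f n m' :=
          Finset.single_le_sum (f := fun m' => j0f n m') (fun i _ => Nat.zero_le _)
            (Finset.mem_range.2 (Nat.lt_succ_of_le hm))
      _ ≤ J₀ := Finset.single_le_sum (f := fun n' => ∑ m' ∈ Finset.range (Nmax + 1), j0f n' m')
            (fun i _ => Nat.zero_le _) (Finset.mem_range.2 (Nat.lt_succ_of_le hn))
  obtain ⟨J₁, hJ₁⟩ : ∃ J₁ : ℕ, ∀ j, J₁ ≤ j → |wilsonTorusMean r.ρ β (Sq j) r.curvature.F - mi| ≤ δm := by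
    have h := Metric.tendsto_atTop.1 hmi δm hδm0
    obtain ⟨N, hN⟩ := h
    exact ⟨N, fun j hj => (Real.dist_eq _ _ ▸ (hN j hj)).le⟩
  -- ## the torus
  set jst : ℕ := max J₀ J₁ with hjst
  set L : ℕ := Sq jst with hL
  refine ⟨L, (hSq𝓛 jst).1, (le_max_left _ _).trans (hSq𝓛 jst).2, ?_⟩
  have hRL : R ≤ L := (le_max_right _ _).trans (hSq𝓛 jst).2
  intro n m F H T hn hm hF hH σ hσ
  -- ## the data at this torus
  set mcL : ℝ := wilsonTorusMean r.ρ β L r.curvature.F with hmcLdef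
  have hmcL : |mcL| ≤ MP := klevel_abs_mean_le r β L hMP
  have hmcLmi : |mcL - mi| ≤ δm := hJ₁ jst (le_max_right _ _)
  set f : ℝ := schwartzNorm (8 * n) F with hf
  set h : ℝ := schwartzNorm (8 * m) H with hh
  have hf0 : 0 ≤ f := schwartzNorm_nonneg _ _
  have hh0 : 0 ≤ h := schwartzNorm_nonneg _ _
  -- weights of the near representatives and their time support
  let wF : (Fin n → ↥(box 4 R)) → ℂ := fun x => F (fun i => a • siteToE (↑(x i) : Site 4))
  let wH : (Fin m → ↥(box 4 R)) → ℂ := fun x => H (fun i => a • siteToE (↑(x i) : Site 4))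
  have hwFt : ∀ x, wF x ≠ 0 → ∀ i, 1 ≤ (↑(x i) : Site 4) 0 ∧ (↑(x i) : Site 4) 0 ≤ ((⌈T / a⌉₊ : ℕ) : ℤ) :=
    fun x hx i => csclLattice_time_of_ne_zero ha F hF (x := fun i => (↑(x i) : Site 4)) hx i
  have hwHt : ∀ y, wH y ≠ 0 → ∀ i, 1 ≤ (↑(y i) : Site 4) 0 ∧ (↑(y i) : Site 4) 0 ≤ ((⌈T / a⌉₊ : ℕ) : ℤ) :=
    fun y hy i => csclLattice_time_of_ne_zero ha H hH (x := fun i => (↑(y i) : Site 4)) hy i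
  -- the four observables
  let X : LGConfig 4 G → ℂ := fun V => ∑ x : Fin n → ↥(box 4 L), F (fun i => a • siteToE ↑(x i)) *
    ∏ i, ((r.curvature.F (configShift (-↑(x i)) V) - mcL : ℝ) : ℂ)
  let X' : LGConfig 4 G → ℂ := fun V => ∑ x : Fin n → ↥(box 4 R), wF x *
    ∏ i, ((r.curvature.F (configShift (-↑(x i)) V) - mi : ℝ) : ℂ)
  let Y : LGConfig 4 G → ℂ := fun V => ∑ x : Fin m → ↥(box 4 L), H (fun i => a • siteToE ↑(x i)) *
    ∏ i, ((r.curvature.F (configShift (-↑(x i)) V) - mcL : ℝ) : ℂ)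
  let Y' : LGConfig 4 G → ℂ := fun V => ∑ x : Fin m → ↥(box 4 R), wH x *
    ∏ i, ((r.curvature.F (configShift (-↑(x i)) V) - mi : ℝ) : ℂ)
  -- measurability
  have hXm : Measurable X := csclLattice_rep_measurable r.curvature (fun x : Fin n → ↥(box 4 L) => F (fun i => a • siteToE (↑(x i) : Site 4))) mcL
  have hX'm : Measurable X' := csclLattice_rep_measurable r.curvature wF mi
  have hYm : Measurable Y := csclLattice_rep_measurable r.curvature (fun x : Fin m → ↥(box 4 L) => H (fun i => a • siteToE (↑(x i) : Site 4))) mcL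
  have hY'm : Measurable Y' := csclLattice_rep_measurable r.curvature wH mi
  -- coefficient sums
  have hSF : ∑ x : Fin n → ↥(box 4 R), ‖wF x‖ ≤ Cstar * f := (hCsum n R F).trans
    (mul_le_mul_of_nonneg_right (hCle n hn) hf0)
  have hSH : ∑ y : Fin m → ↥(box 4 R), ‖wH y‖ ≤ Cstar * h := (hCsum m R H).trans
    (mul_le_mul_of_nonneg_right (hCle m hm) hh0)
  have hSFL : ∑ x : Fin n → ↥(box 4 L), ‖F (fun i => a • siteToE (↑(x i) : Site 4))‖ ≤ Cstar * f :=
    (hCsum n L F).trans (mul_le_mul_of_nonneg_right (hCle n hn) hf0)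
  have hSHL : ∑ x : Fin m → ↥(box 4 L), ‖H (fun i => a • siteToE (↑(x i) : Site 4))‖ ≤ Cstar * h :=
    (hCsum m L H).trans (mul_le_mul_of_nonneg_right (hCle m hm) hh0)
  -- monomial bounds
  have hmonoL : ∀ k, k ≤ Nmax → (MP + |mcL|) ^ k ≤ Bmono := fun k hk =>
    (pow_le_pow_left₀ (by positivity) (by linarith [hmcL]) k).trans (hBle k hk)
  have hmonoi : ∀ k, k ≤ Nmax → (MP + |mi|) ^ k ≤ Bmono := fun k hk =>
    (pow_le_pow_left₀ (by positivity) (by linarith [hmiMP]) k).trans (hBle k hk)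
  -- sup bounds
  have hBX : ∀ V, ‖X V‖ ≤ Bstar * f := fun V => by
    refine (klevel_rep_norm_le r (fun x : Fin n → ↥(box 4 L) => F (fun i => a • siteToE (↑(x i) : Site 4))) mcL hMP V).trans ?_
    calc (∑ x : Fin n → ↥(box 4 L), ‖F (fun i => a • siteToE (↑(x i) : Site 4))‖) * (MP + |mcL|) ^ n
        ≤ (Cstar * f) * Bmono := mul_le_mul hSFL (hmonoL n hn) (by positivity)
          (mul_nonneg hCstar0 hf0)
      _ = Bstar * f := by simp only [hBstar]; ring
  have hBX' : ∀ V, ‖X' V‖ ≤ Bstar * f := fun V => by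
    refine (klevel_rep_norm_le r wF mi hMP V).trans ?_
    calc (∑ x : Fin n → ↥(box 4 R), ‖wF x‖) * (MP + |mi|) ^ n
        ≤ (Cstar * f) * Bmono := mul_le_mul hSF (hmonoi n hn) (by positivity) (mul_nonneg hCstar0 hf0)
      _ = Bstar * f := by simp only [hBstar]; ring
  have hBY : ∀ V, ‖Y V‖ ≤ Bstar * h := fun V => by
    refine (klevel_rep_norm_le r (fun x : Fin m → ↥(box 4 L) => H (fun i => a • siteToE (↑(x i) : Site 4))) mcL hMP V).trans ?_
    calc (∑ x : Fin m → ↥(box 4 L), ‖H (fun i => a • siteToE (↑(x i) : Site 4))‖) * (MP + |mcL|) ^ m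
        ≤ (Cstar * h) * Bmono := mul_le_mul hSHL (hmonoL m hm) (by positivity)
          (mul_nonneg hCstar0 hh0)
      _ = Bstar * h := by simp only [hBstar]; ring
  have hBY' : ∀ V, ‖Y' V‖ ≤ Bstar * h := fun V => by
    refine (klevel_rep_norm_le r wH mi hMP V).trans ?_
    calc (∑ x : Fin m → ↥(box 4 R), ‖wH x‖) * (MP + |mi|) ^ m
        ≤ (Cstar * h) * Bmono := mul_le_mul hSH (hmonoi m hm) (by positivity) (mul_nonneg hCstar0 hh0)
      _ = Bstar * h := by simp only [hBstar]; ring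
  -- the near/far sup-norm perturbation `η* ≤ ηtar`
  set ηstar : ℝ := Bmono * (2 ^ (8 * Nmax) * εR + Nmax * δm * Cstar) with hηstar
  have hηstar0 : 0 ≤ ηstar :=
    mul_nonneg hBmono0.le (add_nonneg (mul_nonneg (by positivity) hεR0.le)
      (mul_nonneg (mul_nonneg (Nat.cast_nonneg _) hδm0.le) hCstar0))
  have hηtar_le : ηstar ≤ ηtar := by
    have h1 : Bmono * (2 ^ (8 * Nmax) * εR) ≤ ηtar / 2 := by
      have hD : (0:ℝ) < 2 * Bmono * 2 ^ (8 * Nmax) + 1 := by positivity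
      have hεR' : εR * (2 * Bmono * 2 ^ (8 * Nmax) + 1) = ηtar := by
        rw [hεR]; field_simp
      have heq : Bmono * (2 ^ (8 * Nmax) * εR) = (ηtar - εR) / 2 := by rw [← hεR']; ring
      rw [heq]; linarith [hεR0.le]
    have h2 : Bmono * (Nmax * δm * Cstar) ≤ ηtar / 2 := by
      have hD : (0:ℝ) < 2 * Bmono * Nmax * Cstar + 1 := by positivity
      have hδm' : δm * (2 * Bmono * Nmax * Cstar + 1) = ηtar := by
        rw [hδm]; field_simp
      have heq : Bmono * (Nmax * δm * Cstar) = (ηtar - δm) / 2 := by rw [← hδm']; ring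
      rw [heq]; linarith [hδm0.le]
    calc ηstar = Bmono * (2 ^ (8 * Nmax) * εR) + Bmono * (Nmax * δm * Cstar) := by simp only [hηstar]; ring
      _ ≤ ηtar / 2 + ηtar / 2 := add_le_add h1 h2
      _ = ηtar := by ring
  have hηX : ∀ V, ‖X V - X' V‖ ≤ ηstar * f := fun V =>
    ((hNF G r β).2 n R L a mcL mi MP F hRL hMP hmcL hmiMP V).trans
      (klevel_rhs_bound F hn hMP0 (hBle n hn) hεR0.le hmcLmi (htail n hn) (hCsum n L F |>.trans
        (mul_le_mul_of_nonneg_right (hCle n hn) hf0)))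
  have hηY : ∀ V, ‖Y V - Y' V‖ ≤ ηstar * h := fun V =>
    ((hNF G r β).2 m R L a mcL mi MP H hRL hMP hmcL hmiMP V).trans
      (klevel_rhs_bound H hm hMP0 (hBle m hm) hεR0.le hmcLmi (htail m hm) (hCsum m L H |>.trans
        (mul_le_mul_of_nonneg_right (hCle m hm) hh0)))
  -- ## sup-norm perturbation of the three centred pairings (at `L`)
  have hP1 := (hNF G r β).1 L X X' Y Y' (Bstar * f) (Bstar * h) (ηstar * f) (ηstar * h) hXm hX'm hYm hY'm hBX hBX'
    hBY hBY' hηX hηY σ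
  have hP2 := (hNF G r β).1 L X X' X X' (Bstar * f) (Bstar * f) (ηstar * f) (ηstar * f) hXm hX'm hXm hX'm hBX hBX'
    hBX hBX' hηX hηX 0
  have hP3 := (hNF G r β).1 L Y Y' Y Y' (Bstar * h) (Bstar * h) (ηstar * h) (ηstar * h) hYm hY'm hYm hY'm hBY hBY'
    hBY hBY' hηY hηY 0
  -- ## the limit inequality for the near representatives and the complex limits of the variances
  obtain ⟨vX, vY, hvX, hvY, hlσ⟩ := hLimit G r β μ mi S₁ (⌈T / a⌉₊) n m R Sq wF wH hβ hμ hSq hSqS₁ hlock hwFt hwHt hraw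
  obtain ⟨lσ, hlσt, hlσle⟩ := hlσ σ
  obtain ⟨_, _, _, _, hlXX⟩ := hLimit G r β μ mi S₁ (⌈T / a⌉₊) n n R Sq wF wF hβ hμ hSq hSqS₁ hlock hwFt hwFt hraw
  obtain ⟨lXX, hlXXt, _⟩ := hlXX 0
  obtain ⟨_, _, _, _, hlYY⟩ := hLimit G r β μ mi S₁ (⌈T / a⌉₊) m m R Sq wH wH hβ hμ hSq hSqS₁ hlock hwHt hwHt hraw
  obtain ⟨lYY, hlYYt, _⟩ := hlYY 0
  have hvXre : vX = lXX.re := tendsto_nhds_unique hvX ((Complex.continuous_re.tendsto _).comp hlXXt)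
  have hvYre : vY = lYY.re := tendsto_nhds_unique hvY ((Complex.continuous_re.tendsto _).comp hlYYt)
  -- ## kernel uniformity at `jst ≥ J₀`
  have hjst0 : ∀ k k', k ≤ Nmax → k' ≤ Nmax → j0f k k' ≤ jst := fun k k' hk hk' =>
    (hJ₀le k k' hk hk').trans (le_max_left _ _)
  have hK1 := hj0f n m jst (hjst0 n m hn hm) wF wH σ lσ hσ hlσt
  have hK2 := hj0f n n jst (hjst0 n n hn hn) wF wF 0 lXX (Nat.zero_le _) hlXXt
  have hK3 := hj0f m m jst (hjst0 m m hm hm) wH wH 0 lYY (Nat.zero_le _) hlYYt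
  -- ## variance majorisation `Re 𝒫°₀(X,X) ≤ ‖𝒫₀(X,X)‖` and `‖𝒫₀(X,X)‖ ≤ B_X²`
  haveI := isProbabilityMeasure_wilsonMeasure (d := 4) (L := 2 * L + 1) r.ρ r.continuous β
  have hreX : ∀ (P m' : ℂ), (P - (starRingEnd ℂ) m' * m').re ≤ ‖P‖ := fun P m' => by
    have h1 : ((starRingEnd ℂ) m' * m').re = m'.re * m'.re + m'.im * m'.im := by
      simp only [Complex.mul_re, Complex.conj_re, Complex.conj_im]; ring
    have h2 : 0 ≤ m'.re * m'.re + m'.im * m'.im := add_nonneg (mul_self_nonneg _) (mul_self_nonneg _)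
    rw [Complex.sub_re, h1]
    linarith [Complex.re_le_norm P]
  have hPXle : ‖∫ U : GaugeConfig 4 (2 * L + 1) G, (starRingEnd ℂ) (X (cfgReflect (torusLift (2 * L + 1) U))) *
      X (configShift (-(Pi.single 0 ((0 : ℕ) : ℤ))) (torusLift (2 * L + 1) U)) ∂(wilsonMeasure r.ρ β)‖ ≤ (Bstar * f) ^ 2 := by
    have h0 := norm_integral_le_of_norm_le_const (μ := wilsonMeasure (d := 4) (L := 2 * L + 1) r.ρ β)
      (C := Bstar * f * (Bstar * f))
      (f := fun U : GaugeConfig 4 (2 * L + 1) G => (starRingEnd ℂ) (X (cfgReflect (torusLift (2 * L + 1) U))) *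
        X (configShift (-(Pi.single 0 ((0 : ℕ) : ℤ))) (torusLift (2 * L + 1) U)))
      (Eventually.of_forall fun U => by
        rw [norm_mul, Complex.norm_conj]
        exact mul_le_mul (hBX _) (hBX _) (norm_nonneg _) (mul_nonneg hBstar0 hf0))
    simpa [sq, probReal_univ] using h0
  have hPYle : ‖∫ U : GaugeConfig 4 (2 * L + 1) G, (starRingEnd ℂ) (Y (cfgReflect (torusLift (2 * L + 1) U))) *
      Y (configShift (-(Pi.single 0 ((0 : ℕ) : ℤ))) (torusLift (2 * L + 1) U)) ∂(wilsonMeasure r.ρ β)‖ ≤ (Bstar * h) ^ 2 := by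
    have h0 := norm_integral_le_of_norm_le_const (μ := wilsonMeasure (d := 4) (L := 2 * L + 1) r.ρ β)
      (C := Bstar * h * (Bstar * h))
      (f := fun U : GaugeConfig 4 (2 * L + 1) G => (starRingEnd ℂ) (Y (cfgReflect (torusLift (2 * L + 1) U))) *
        Y (configShift (-(Pi.single 0 ((0 : ℕ) : ℤ))) (torusLift (2 * L + 1) U)))
      (Eventually.of_forall fun U => by
        rw [norm_mul, Complex.norm_conj]
        exact mul_le_mul (hBY _) (hBY _) (norm_nonneg _) (mul_nonneg hBstar0 hh0))
    simpa [sq, probReal_univ] using h0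
  -- ## the chain and the budget
  have hμσ : 0 ≤ μ * σ := mul_nonneg hμ.le (Nat.cast_nonneg _)
  have he1 : Real.exp (-(μ * σ)) ≤ 1 := by rw [Real.exp_le_one_iff]; linarith
  have hchain := klevel_chain hP1 hP2 hP3 hK1 hK2 hK3 hlσle (Real.exp_pos _).le he1 hvXre hvYre (hreX _ _) (hreX _ _)
    hδB0.le (Finset.sum_nonneg fun x _ => norm_nonneg _) (Finset.sum_nonneg fun x _ => norm_nonneg _)
    (mul_nonneg hηstar0 hf0) (mul_nonneg hηstar0 hh0) (mul_nonneg hBstar0 hf0) (mul_nonneg hBstar0 hh0)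
  have hbudget := klevel_budget (PX := ‖∫ U : GaugeConfig 4 (2 * L + 1) G, (starRingEnd ℂ) (X (cfgReflect (torusLift (2 * L + 1) U))) *
      X (configShift (-(Pi.single 0 ((0 : ℕ) : ℤ))) (torusLift (2 * L + 1) U)) ∂(wilsonMeasure r.ρ β)‖)
    (PY := ‖∫ U : GaugeConfig 4 (2 * L + 1) G, (starRingEnd ℂ) (Y (cfgReflect (torusLift (2 * L + 1) U))) *
      Y (configShift (-(Pi.single 0 ((0 : ℕ) : ℤ))) (torusLift (2 * L + 1) U)) ∂(wilsonMeasure r.ρ β)‖)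
    hθ0 hθ1 hθτ hBstar0 hCstar0 hf0 hh0 hδB hηtar hηtar_le hSF hSH
    (Finset.sum_nonneg fun x _ => norm_nonneg _) (Finset.sum_nonneg fun x _ => norm_nonneg _) hPXle hPYle
  exact hchain.trans (by linarith [hbudget])

end Main


/-- **`stub_csclKLevel`** (registered glue stub of line `Sketch`, reshape 18b) — uniform Cauchy–Schwarz clustering on a late
torus for all test functions of bounded complexity: `klevel_main` with the landed `stub_csclLimitCS`, `stub_csclKernel`,
`stub_csclNearFar`. [folklore] -/
theorem stub_csclKLevel :
    ∀ (G : Type) [Group G] [TopologicalSpace G] [IsTopologicalGroup G] [CompactSpace G]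
      [MeasurableSpace G] [BorelSpace G] (r : LatticeRep G) (β μ a : ℝ) (S₁ : ℕ) (𝓛 : Set ℕ),
      0 ≤ β → 0 < μ → 0 < a → (∀ S : ℕ, ∃ S' : ℕ, S' ∈ 𝓛 ∧ S ≤ S') → (∀ S ∈ 𝓛, S₁ ≤ S) →
      (∀ A B : YMSpecies G, ∃ C : ℝ, ∀ S n : ℕ, S₁ ≤ S → n ≤ S →
        |latticeConnectedCorr r.ρ β (2 * S + 1) A.F B.F n| ≤ C * Real.exp (-(μ * n))) →
      ∀ (τ : ℝ) (Nmax σmax Lmin : ℕ), 0 < τ → ∃ L : ℕ, L ∈ 𝓛 ∧ Lmin ≤ L ∧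
        ∀ (n m : ℕ) (F : SchwartzMap (Fin n → EuclideanSpace ℝ (Fin 4)) ℂ)
          (H : SchwartzMap (Fin m → EuclideanSpace ℝ (Fin 4)) ℂ) (T : ℝ), n ≤ Nmax → m ≤ Nmax →
          tsupport (F : (Fin n → EuclideanSpace ℝ (Fin 4)) → ℂ) ⊆ {x | ∀ i, a ≤ x i 0 ∧ x i 0 ≤ T} →
          tsupport (H : (Fin m → EuclideanSpace ℝ (Fin 4)) → ℂ) ⊆ {x | ∀ i, a ≤ x i 0 ∧ x i 0 ≤ T} →
          ∀ σ : ℕ, σ ≤ σmax →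
            ‖((∫ U : GaugeConfig 4 (2 * L + 1) G, (starRingEnd ℂ) ((fun V => ∑ x : Fin n → ↥(box 4 L), F (fun i => a • siteToE ↑(x i)) * ∏ i, ((r.curvature.F (configShift (-↑(x i)) V) - (wilsonTorusMean r.ρ β L r.curvature.F) : ℝ) : ℂ)) (cfgReflect (torusLift (2 * L + 1) U))) * (fun V => ∑ x : Fin m → ↥(box 4 L), H (fun i => a • siteToE ↑(x i)) * ∏ i, ((r.curvature.F (configShift (-↑(x i)) V) - (wilsonTorusMean r.ρ β L r.curvature.F) : ℝ) : ℂ)) (configShift (-(Pi.single 0 ((σ : ℕ) : ℤ))) (torusLift (2 * L + 1) U)) ∂(wilsonMeasure r.ρ β)) - (starRingEnd ℂ) (∫ U : GaugeConfig 4 (2 * L + 1) G, (fun V => ∑ x : Fin n → ↥(box 4 L), F (fun i => a • siteToE ↑(x i)) * ∏ i, ((r.curvature.F (configShift (-↑(x i)) V) - (wilsonTorusMean r.ρ β L r.curvature.F) : ℝ) : ℂ)) (torusLift (2 * L + 1) U) ∂(wilsonMeasure r.ρ β)) * (∫ U : GaugeConfig 4 (2 * L + 1) G, (fun V => ∑ x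 : Fin m → ↥(box 4 L), H (fun i => a • siteToE ↑(x i)) * ∏ i, ((r.curvature.F (configShift (-↑(x i)) V) - (wilsonTorusMean r.ρ β L r.curvature.F) : ℝ) : ℂ)) (torusLift (2 * L + 1) U) ∂(wilsonMeasure r.ρ β)))‖ ≤
              Real.exp (-(μ * σ)) * Real.sqrt ‖∫ U : GaugeConfig 4 (2 * L + 1) G, (starRingEnd ℂ) ((fun V => ∑ x : Fin n → ↥(box 4 L), F (fun i => a • siteToE ↑(x i)) * ∏ i, ((r.curvature.F (configShift (-↑(x i)) V) - (wilsonTorusMean r.ρ β L r.curvature.F) : ℝ) : ℂ)) (cfgReflect (torusLift (2 * L + 1) U))) * (fun V => ∑ x : Fin n → ↥(box 4 L), F (fun i => a • siteToE ↑(x i)) * ∏ i, ((r.curvature.F (configShift (-↑(x i)) V) - (wilsonTorusMean r.ρ β L r.curvature.F) : ℝ) : ℂ)) (configShift (-(Pi.single 0 ((0 : ℕ) : ℤ))) (torusLift (2 * L + 1) U)) ∂(wilsonMeasure r.ρ β)‖ *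
                Real.sqrt ‖∫ U : GaugeConfig 4 (2 * L + 1) G, (starRingEnd ℂ) ((fun V => ∑ x : Fin m → ↥(box 4 L), H (fun i => a • siteToE ↑(x i)) * ∏ i, ((r.curvature.F (configShift (-↑(x i)) V) - (wilsonTorusMean r.ρ β L r.curvature.F) : ℝ) : ℂ)) (cfgReflect (torusLift (2 * L + 1) U))) * (fun V => ∑ x : Fin m → ↥(box 4 L), H (fun i => a • siteToE ↑(x i)) * ∏ i, ((r.curvature.F (configShift (-↑(x i)) V) - (wilsonTorusMean r.ρ β L r.curvature.F) : ℝ) : ℂ)) (configShift (-(Pi.single 0 ((0 : ℕ) : ℤ))) (torusLift (2 * L + 1) U)) ∂(wilsonMeasure r.ρ β)‖ +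
              τ * schwartzNorm (8 * n) F * schwartzNorm (8 * m) H :=
  klevel_main stub_csclLimitCS stub_csclKernel stub_csclNearFar

end Summit.QuantumFields.YangMills.Theorems.ContinuumLegGivenGap

end
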